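import Summits.AtomisticToContinuum.FouriersLaw.Theorems.PhononMeanFreePathIncoherentChannelVarianceTransportHelper1
import Summits.AtomisticToContinuum.FouriersLaw.Theorems.BondHeatUncertaintyExtensiveSnapshotIrreversibilityClausiusBudgetKinetics

/-!
# `IncoherentChannel`, line `two-horizons-forecast-loss` — the forecast norm `S_N(t)` is non-increasing in `t`

Helper file for the lead's stub `stub_forecastLoss` of crux `PhononMeanFreePath.IncoherentChannel`
(item stmt-AtomisticToContinuum-11811, route `PhononMeanFreePath`, sub-problem `FouriersLaw`), vocabulary of
`PhononMeanFreePathDefs`. For the `(N+1)`-site pinned anharmonic chain `pinnedChain ω₂ lam β γ` with both baths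
at `T` (`μ₀ = gibbsMeasure (N+1) T`, `K_t = transitionKernel (N+1) T T t⁺`, the CONSTRUCTED objects) write
`v_t = fcast … N t = K_t p_N` (mean forecast of the far momentum) and `S_N(t) = fnorm … N t = ‖v_t‖²_{L²(μ₀)}`.

* `fnormMono_fcast_add` — Chapman–Kolmogorov for the mean forecast: `v_{d+s} = K_d v_s` (`d, s ≥ 0`);
* `fnormMono_fcast_abs_le_exp` — a fixed-`N` weight bound `|v_s| ≤ A e^{H/(4T)}`, uniform in `s ≥ 0`;
* `fnorm_antitone` (registered) — **`S_N(t) ≤ S_N(s)` for `0 ≤ s ≤ t`**: the `L²(μ₀)`-contraction of the Markov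
  kernel `K_{t-s}` (Jensen pointwise, then Gibbs invariance of `K_{t-s}`), applied to `f = v_s`.

The STRUCTURE fact is uniform in `N` (no constant enters the inequality); the weight bound is only used to put
`v_s` in the domain of the contraction lemma. Inputs: `LangevinChainKernel.pinnedChain_transitionKernel_add`,
`ClausiusBudget.pinnedChain_integral_sq_act_le_of_stronglyMeasurable`, `varianceTransport_fcast_abs_le_exp`.
No definitions; nothing here closes an item.
-/

noncomputable section

namespace Summit.AtomisticToContinuum.FouriersLaw.Theorems.PhononMeanFreePath

open MeasureTheory ProbabilityTheory Set Filter Topology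
open scoped NNReal ENNReal
open Literature.MathematicalPhysics.KineticTheory.HeatConduction
open Literature.MathematicalPhysics.KineticTheory Literature.Probability.Process OscillatorChain
open Summit.AtomisticToContinuum.FouriersLaw.Theorems.SubdiffusiveBondHeat
open Summit.AtomisticToContinuum.FouriersLaw.Theorems.IncoherentBounded
open Summit.AtomisticToContinuum.FouriersLaw.Theorems.ExtensiveSnapshotIrreversibility.ClausiusBudget

section FixedN

variable {ω₂ lam β γ T : ℝ}

/-- **Chapman–Kolmogorov for the mean forecast**: for `d, s ≥ 0` and every microstate `z`,
`v_{d+s}(z) = ∫ v_s dK_d(z, ·)`, i.e. `K_{d+s} p_N = K_d (K_s p_N)` (`pinnedChain_transitionKernel_add` and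
`Kernel.integral_comp`; `p_N` is integrable for every `K_u(z, ·)`, CEHR (3.4)).
[cite: CuneoEckmannHairerReyBellet2018, §3 p. 7] -/
theorem fnormMono_fcast_add (hω : 0 < ω₂) (hl : 0 ≤ lam) (hβ : 0 ≤ β) (hγ : 0 ≤ γ) (hT : 0 < T) (N : ℕ)
    {d s : ℝ} (hd : 0 ≤ d) (hs : 0 ≤ s) (z : PhaseSpace (N + 1)) :
    fcast ω₂ lam β γ T N (d + s) z =
      ∫ x, fcast ω₂ lam β γ T N s x ∂((pinnedChain ω₂ lam β γ).transitionKernel (N + 1) T T d.toNNReal z) := by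
  set P := pinnedChain ω₂ lam β γ with hP
  set κ := P.transitionKernel (N + 1) T T with hκ
  have hadd : κ (d + s).toNNReal = κ s.toNNReal ∘ₖ κ d.toNNReal := by
    rw [Real.toNNReal_add hd hs, hκ, pinnedChain_transitionKernel_add hω hl hβ hγ (N + 1) T T]
  have hϑ0 : (0 : ℝ) < 1 / (4 * T) := by positivity
  have hϑ1 : 1 / (4 * T) < 1 / T := by
    rw [div_lt_div_iff₀ (by positivity) hT]; nlinarith
  have hgint : Integrable (fun y : PhaseSpace (N + 1) => y.2 (Fin.last N))
      ((κ s.toNNReal ∘ₖ κ d.toNNReal) z) := by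
    rw [← hadd]
    exact integrable_of_abs_le_exp
      (pinnedChain_integrable_exp_mul_hamiltonian_transitionKernel hω hl hT hβ hγ (Nat.succ_pos N) hϑ0
        hϑ1 _ z)
      (by fun_prop) (fun y => abs_momentum_le_exp hω hl hβ hϑ0 y (Fin.last N))
  show ∫ y, y.2 (Fin.last N) ∂(κ (d + s).toNNReal z) =
    ∫ x, (∫ y, y.2 (Fin.last N) ∂(κ s.toNNReal x)) ∂(κ d.toNNReal z)
  rw [hadd]
  exact Kernel.integral_comp hgint

/-- **A weight bound on the mean forecast, uniform in time** (fixed `N`): there is `A > 0` with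
`|v_s(y)| ≤ A e^{H(y)/(4T)}` for all `s ≥ 0` and all `y` (drop the decay factor `e^{-cs} ≤ 1` in
`varianceTransport_fcast_abs_le_exp`). [cite: CuneoEckmannHairerReyBellet2018, Thm 2.13 (3)] -/
theorem fnormMono_fcast_abs_le_exp (hω : 0 < ω₂) (hl : 0 ≤ lam) (hβ : 0 < β) (hγ : 0 < γ) (hT : 0 < T)
    (N : ℕ) :
    ∃ A : ℝ, 0 < A ∧ ∀ s : ℝ, 0 ≤ s → ∀ y : PhaseSpace (N + 1),
      |fcast ω₂ lam β γ T N s y| ≤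
        A * Real.exp (1 / (4 * T) * (pinnedChain ω₂ lam β γ).hamiltonian (N + 1) y) := by
  have hϑ0 : (0 : ℝ) < 1 / (4 * T) := by positivity
  have hϑ1 : 1 / (4 * T) < 1 / T := by
    rw [div_lt_div_iff₀ (by positivity) hT]; nlinarith
  obtain ⟨A, c, hA, hc, hb⟩ := varianceTransport_fcast_abs_le_exp hω hl hβ hγ hT N hϑ0 hϑ1
  refine ⟨A, hA, fun s hs y => ?_⟩
  have he : Real.exp (-c * s) ≤ 1 := Real.exp_le_one_iff.2 (by nlinarith)
  have hAe : 0 ≤ A * Real.exp (1 / (4 * T) * (pinnedChain ω₂ lam β γ).hamiltonian (N + 1) y) :=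
    mul_nonneg hA.le (Real.exp_pos _).le
  calc |fcast ω₂ lam β γ T N s y|
      ≤ A * Real.exp (1 / (4 * T) * (pinnedChain ω₂ lam β γ).hamiltonian (N + 1) y) * Real.exp (-c * s) :=
        hb s hs y
    _ ≤ A * Real.exp (1 / (4 * T) * (pinnedChain ω₂ lam β γ).hamiltonian (N + 1) y) * 1 :=
        mul_le_mul_of_nonneg_left he hAe
    _ = A * Real.exp (1 / (4 * T) * (pinnedChain ω₂ lam β γ).hamiltonian (N + 1) y) := mul_one _

end FixedN

/-- **The forecast norm is non-increasing: `S_N(t) ≤ S_N(s)` for `0 ≤ s ≤ t`**, for all parameters `> 0`,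
`T > 0` and every `N` (no constant: the structure fact is uniform in `N`). With `d = t - s ≥ 0`,
Chapman–Kolmogorov gives `v_t = K_d v_s` (`fnormMono_fcast_add`), and the `L²(μ₀)`-contraction of the Markov
kernel `K_d` under its invariant probability measure `μ₀` (Jensen `(K_d v_s)² ≤ K_d(v_s²)` pointwise, then
`∫ K_d(v_s²) dμ₀ = ∫ v_s² dμ₀`) yields `S_N(t) = ∫ (K_d v_s)² dμ₀ ≤ ∫ v_s² dμ₀ = S_N(s)`; `v_s` is in the
domain of the contraction lemma by the weight bound `|v_s| ≤ A e^{H/(4T)}` (`fnormMono_fcast_abs_le_exp`).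
Registered helper for `stub_forecastLoss` (line `two-horizons-forecast-loss`): envelopes of `S_N` need only be
checked on a grid or in integrated form. [folklore] -/
theorem fnorm_antitone : ∀ ω₂ lam β γ : ℝ, 0 < ω₂ → 0 < lam → 0 < β → 0 < γ → ∀ T : ℝ, 0 < T → ∀ (N : ℕ) (s t : ℝ), 0 ≤ s → s ≤ t → fnorm ω₂ lam β γ T N t ≤ fnorm ω₂ lam β γ T N s := by
  intro ω₂ lam β γ hω hl' hβ hγ T hT N s t hs hst
  have hl : 0 ≤ lam := hl'.le
  have hd : 0 ≤ t - s := sub_nonneg.2 hst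
  have hϑ0 : (0 : ℝ) < 1 / (4 * T) := by positivity
  have h2ϑ : 2 * (1 / (4 * T)) < 1 / T := by
    rw [show 2 * (1 / (4 * T)) = 1 / (2 * T) by field_simp; ring, div_lt_div_iff₀ (by positivity) hT]
    nlinarith
  obtain ⟨A, -, hb⟩ := fnormMono_fcast_abs_le_exp hω hl hβ hγ hT N
  have hsm : StronglyMeasurable (fcast ω₂ lam β γ T N s) :=
    (by fun_prop : Continuous fun y : PhaseSpace (N + 1) => y.2 (Fin.last N)).stronglyMeasurable.integral_kernel
      (κ := (pinnedChain ω₂ lam β γ).transitionKernel (N + 1) T T s.toNNReal)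
  obtain ⟨-, -, hle⟩ := pinnedChain_integral_sq_act_le_of_stronglyMeasurable hω hl hβ hγ (Nat.succ_pos N) hT
    hϑ0 h2ϑ hsm (hb s hs) (t - s).toNNReal
  have key : ∀ z : PhaseSpace (N + 1), fcast ω₂ lam β γ T N t z =
      ∫ x, fcast ω₂ lam β γ T N s x
        ∂((pinnedChain ω₂ lam β γ).transitionKernel (N + 1) T T (t - s).toNNReal z) := fun z => by
    have h := fnormMono_fcast_add hω hl hβ.le hγ.le hT N hd hs z
    rwa [sub_add_cancel] at h
  calc fnorm ω₂ lam β γ T N t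
      = ∫ z, (∫ x, fcast ω₂ lam β γ T N s x
          ∂((pinnedChain ω₂ lam β γ).transitionKernel (N + 1) T T (t - s).toNNReal z)) ^ 2
          ∂((pinnedChain ω₂ lam β γ).gibbsMeasure (N + 1) T) :=
        integral_congr_ae (Eventually.of_forall fun z => by simp only [key z])
    _ ≤ ∫ z, fcast ω₂ lam β γ T N s z ^ 2 ∂((pinnedChain ω₂ lam β γ).gibbsMeasure (N + 1) T) := hle
    _ = fnorm ω₂ lam β γ T N s := rfl

end Summit.AtomisticToContinuum.FouriersLaw.Theorems.PhononMeanFreePath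

end
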